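import Summits.MatrixMultiplication.MatrixMultiplication.Theorems.CharacteristicContinuityEventualTransfer
import HarnessLib

/-!
# CharacteristicContinuityResidualChain — the residual chain K ⟹ K′ ⟹ K″ on the characteristic axis, BY NAME
(decomp-mm cell, lens 5 «finite/base range + asymptotic regime + bridge», generation 10)

By-name statements for `route-MatrixMultiplication-CharacteristicContinuity` now that the item
`EventualTransfer` (K′, stmt-30790) is a declaration of the route file:

* `matrixMultiplication_iff_fast_and_eventualTransfer'` : `S ↔ W ∧ K′` by name (corner one of the
  characteristic square; the written-out form is in `Theorems/CharacteristicContinuityEventualTransfer`);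
* `matrixMultiplication_of_fast_of_eventualTransfer` : the re-glued closing `W → K′ → S` by name;
* the chain BELOW K′ consists of conditional laws only: `schema_eventual_imp_limTransfer` (K′-shape ⟹
  K″-shape = limit transfer «if ω_p → ℓ then ω₀ ≤ ℓ») and `schema_limTransfer_not_eventual` (K″-shape ↛
  K′-shape, on the abstract profile ω₀ = 3, w = 5/2, 13/5, 5/2, …). K″ is still necessary for S and exact
  with W, but it is silent on non-convergent profiles and its case ℓ = 2 is the bare residual `W → S`;
  K′ is therefore the last UNCONDITIONAL transfer law on W's side of the square.

References: [cite: BurgisserClausenShokrollahi1997, Cor. (15.18)]; [cite: Blaser2013, Def. 5.1].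
-/

set_option linter.dupNamespace false -- `MatrixMultiplication.MatrixMultiplication` (summit = problem, D-0017)

noncomputable section

open Literature.Computability.AlgebraicComplexity
open Summit.MatrixMultiplication.MatrixMultiplication.Theses.CharacteristicContinuity
open Summit.MatrixMultiplication.MatrixMultiplication.Theorems.CharacteristicContinuityTransfer
open Summit.MatrixMultiplication.MatrixMultiplication.Theorems.CharacteristicContinuityEventualTransfer

namespace Summit.MatrixMultiplication.MatrixMultiplication.Theorems.CharacteristicContinuityResidualChain

/-- The re-glued closing `W → K′ → S` (certified glue of ask #15). [folklore] -/
theorem matrixMultiplication_of_fast_of_eventualTransfer (hW : LargeCharacteristicFast)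
    (hK' : EventualTransfer) : _root_.MatrixMultiplication :=
  closes_of_eventualTransfer hW hK'

/-- Corner one, by name: `S ↔ W ∧ K′`. [folklore] -/
theorem matrixMultiplication_iff_fast_and_eventualTransfer' :
    _root_.MatrixMultiplication ↔ LargeCharacteristicFast ∧ EventualTransfer :=
  matrixMultiplication_iff_fast_and_eventualTransfer

/-! ## Below K′: only conditional transfer laws (schema on abstract exponent profiles)

The chain of exact partners of `W` continues below `K′` only with CONDITIONAL laws:
`K″` (limit transfer: if `ω_p → ℓ` then `ω₀ ≤ ℓ`) is implied by `K′`, is still necessary for `S` and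
exact with `W` (under `W` the profile converges to `2`), but is strictly weaker as a law — it is silent
on non-convergent profiles — and its specialisation to `ℓ = 2` is already the bare residual `W → S`.
The two schemas below record this on abstract profiles `(ω₀, w)` (no matrix multiplication content),
exactly like `schema_eventual_not_continuity` of the EventualTransfer module. -/

/-- `K′`-shape → `K″`-shape on abstract profiles: lim-sup transfer implies limit transfer. [folklore] -/
theorem schema_eventual_imp_limTransfer (ω₀ : ℝ) (w : ℕ → ℝ)
    (hK' : ∀ β : ℝ, (∃ p₀ : ℕ, ∀ p : ℕ, p₀ ≤ p → w p ≤ β) → ω₀ ≤ β) :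
    ∀ ℓ : ℝ, Filter.Tendsto w Filter.atTop (nhds ℓ) → ω₀ ≤ ℓ := by
  intro ℓ hℓ
  refine le_of_forall_pos_le_add fun δ hδ => hK' (ℓ + δ) ?_
  have h := (Filter.Tendsto.eventually hℓ (eventually_le_nhds (show ℓ < ℓ + δ by linarith)))
  obtain ⟨p₀, hp₀⟩ := Filter.eventually_atTop.1 h
  exact ⟨p₀, hp₀⟩

/-- `K″`-shape ↛ `K′`-shape: the profile `ω₀ = 3`, `w p = 5/2` (even `p`), `13/5` (odd `p`) has no
limit (so limit transfer holds vacuously) while lim-sup transfer fails at `β = 13/5`. [folklore] -/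
theorem schema_limTransfer_not_eventual :
    ∃ (ω₀ : ℝ) (w : ℕ → ℝ),
      (∀ ℓ : ℝ, Filter.Tendsto w Filter.atTop (nhds ℓ) → ω₀ ≤ ℓ) ∧
      ¬ (∀ β : ℝ, (∃ p₀ : ℕ, ∀ p : ℕ, p₀ ≤ p → w p ≤ β) → ω₀ ≤ β) := by
  refine ⟨3, fun p => if p % 2 = 0 then 5 / 2 else 13 / 5, ?_, ?_⟩
  · intro ℓ hℓ
    exfalso
    -- the constant subsequences along even and odd indices would both converge to `ℓ`
    have h2n : Filter.Tendsto (fun n : ℕ => 2 * n) Filter.atTop Filter.atTop :=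
      Filter.tendsto_atTop_atTop.2 fun b => ⟨b, fun n hn => by omega⟩
    have h2n1 : Filter.Tendsto (fun n : ℕ => 2 * n + 1) Filter.atTop Filter.atTop :=
      Filter.tendsto_atTop_atTop.2 fun b => ⟨b, fun n hn => by omega⟩
    have he' : Filter.Tendsto (fun _ : ℕ => (5 : ℝ) / 2) Filter.atTop (nhds ℓ) :=
      (hℓ.comp h2n).congr fun n => by simp
    have ho' : Filter.Tendsto (fun _ : ℕ => (13 : ℝ) / 5) Filter.atTop (nhds ℓ) :=
      (hℓ.comp h2n1).congr fun n => by simp [Nat.add_mod]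
    have h1 : ℓ = 5 / 2 := tendsto_nhds_unique he' tendsto_const_nhds
    have h2 : ℓ = 13 / 5 := tendsto_nhds_unique ho' tendsto_const_nhds
    linarith
  · intro hK'
    have h := hK' (13 / 5) ⟨0, fun p _ => by
      by_cases hp : p % 2 = 0 <;> norm_num [hp]⟩
    linarith

end Summit.MatrixMultiplication.MatrixMultiplication.Theorems.CharacteristicContinuityResidualChain

end
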